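import Literature.MathematicalPhysics.QuantumFieldTheory.Balaban1983to89.Beta.Composition

/-!
# `BalabanUV.Beta.D1BFx.BorderedInverseMassive` — road «BF-x» for binder row D1, slot (K), `K-ASSEMBLY-SPEC.md` brick TB2 (N-side), part 3a (model):
# THE INVERSE OF THE SHARP-CONSTRAINT BORDERED SYSTEM `kkt K Q` FROM THE MASSIVE RESOLVENT `G = (K + a′·QᵀQ)⁻¹` — finite Woodbury, `[folklore]`

HONEST FRAMING (cell contract, verbatim): «discharging `BetaPertH` makes Bałaban's UV stability UNCONDITIONAL — a real constructive-QFT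
result; it is NOT the continuum limit and NOT the Clay problem.»  HONEST DEPENDENCY (verbatim): «continuum YM on T⁴ ⇐ BetaPertH ∧ nine
spine estimates (0/9 proved); BetaPertH ⇐ (D1) ∧ (D4) ∧ CAP+tail; G-an2-4 gates asym, D1 and NE2/3/4.»  THIS MODULE DISCHARGES NOTHING:
finite-dimensional linear algebra over any field, stated over an2's `Composition.kkt`; no `Prop` is minted, nothing is cited, 0 sorry.  NOT summit
progress; NOT BetaPertH, NOT continuum, NOT Clay.

ABSOLUTE RULE (cell, verbatim): «No internally-minted statement may enter as a cited fact. Every hypothesis is either kernel-proved in this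
package or a verbatim quotation of a PUBLISHED theorem with page reference. The manuscript(s) under audit are NOT citable for their own
disputed steps — they are the thing under adjudication; programme-internal (2001/route/tribunal) claims are never citable.»

WHY (`HOME/b2b-balaban-beta-d1-p2/K-ASSEMBLY-SPEC.md` v1 §1 TB2).  On a cubic torus the massive vector resolvent is the periodised gluon leg
(`VectorPropagatorImages.periodiseF_GaF_eq_calG_re`: `per GaF = ((m+1)²·Re calG_T) = (per X1aKer)⁻¹`, `X1aKer = ½S + dRδ + a′𝒬ᵀ𝒬`), while the
N-system of the slice-transfer identity is the SHARP-constraint bordered matrix `kkt (½Ŝ + dR̂δ̂) 𝒬̂` WITHOUT the mass `a′𝒬ᵀ𝒬`.  This file is the finite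
identity that converts one into the other: the mass term is invisible on the constraint surface except for the shift `a′` of the multiplier block.

CONTENT.  `kkt_mul_massiveBlocks`: if `(K + a′·QᵀQ)·G = 1` and `(Q·G·Qᵀ)·C = 1` then
`kkt K Q · [[G − GQᵀCQG, GQᵀC],[CQG, a′·1 − C]] = 1`; `massiveBlocks_mul_kkt` (the left-inverse form under the transposed hypotheses
`G·(K + a′·QᵀQ) = 1`, `C·(QGQᵀ) = 1`); `kkt_inv_eq_massiveBlocks` (hence `(kkt K Q)⁻¹ =` that block matrix, and `kkt K Q` is invertible).
Unit `b2b-balaban-beta-d1-p2` (road owner, gen 5).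
-/

namespace Summit.QuantumFields.BalabanUV.Beta.D1BFx.BorderedInverseMassive

open Matrix
open Literature.MathematicalPhysics.QuantumFieldTheory.Balaban1983to89.Beta.Composition (kkt)

variable {𝕜 : Type*} [Field 𝕜] {ν μ : Type*} [Fintype ν] [Fintype μ] [DecidableEq ν] [DecidableEq μ]

/-- [our object] The candidate inverse of the sharp-constraint bordered system built from the massive resolvent `G` and the coarse inverse `C`:
`[[G − GQᵀCQG, GQᵀC],[CQG, a′·1 − C]]`. -/
def massiveBlocks (G : Matrix ν ν 𝕜) (Q : Matrix μ ν 𝕜) (C : Matrix μ μ 𝕜) (a' : 𝕜) : Matrix (ν ⊕ μ) (ν ⊕ μ) 𝕜 :=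
  Matrix.fromBlocks (G - G * Qᵀ * C * Q * G) (G * Qᵀ * C) (C * Q * G) (a' • (1 : Matrix μ μ 𝕜) - C)

/-- [folklore] **RIGHT INVERSE**: `(K + a′QᵀQ)G = 1` and `(QGQᵀ)C = 1` ⟹ `kkt K Q · massiveBlocks G Q C a′ = 1`. -/
theorem kkt_mul_massiveBlocks (K G : Matrix ν ν 𝕜) (Q : Matrix μ ν 𝕜) (C : Matrix μ μ 𝕜) (a' : 𝕜)
    (hG : (K + a' • (Qᵀ * Q)) * G = 1) (hC : (Q * G * Qᵀ) * C = 1) :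
    kkt K Q * massiveBlocks G Q C a' = 1 := by
  have hKG : K * G = 1 - a' • (Qᵀ * Q * G) := by
    rw [Matrix.add_mul, Matrix.smul_mul] at hG
    rw [← hG]; abel
  have hC' : Q * G * Qᵀ * C = 1 := hC
  rw [kkt, massiveBlocks, Matrix.fromBlocks_multiply, ← Matrix.fromBlocks_one]
  congr 1
  · -- (1,1): K(G − GQᵀCQG) + Qᵀ(CQG) = 1
    have e1 : K * (G - G * Qᵀ * C * Q * G) = K * G - K * G * Qᵀ * C * Q * G := by
      rw [Matrix.mul_sub]; simp only [Matrix.mul_assoc]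
    rw [e1, hKG]
    have e2 : (1 - a' • (Qᵀ * Q * G)) * Qᵀ * C * Q * G
        = Qᵀ * C * Q * G - a' • (Qᵀ * (Q * G * Qᵀ * C) * Q * G) := by
      rw [Matrix.sub_mul, Matrix.sub_mul, Matrix.sub_mul, Matrix.sub_mul, Matrix.one_mul]
      simp only [Matrix.smul_mul, Matrix.mul_assoc]
    rw [e2, hC', Matrix.mul_one]
    simp only [Matrix.mul_assoc]
    abel
  · -- (1,2): K(GQᵀC) + Qᵀ(a′ − C) = 0
    have e1 : K * (G * Qᵀ * C) = K * G * Qᵀ * C := by simp only [Matrix.mul_assoc]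
    rw [e1, hKG, Matrix.sub_mul, Matrix.sub_mul, Matrix.one_mul, Matrix.smul_mul, Matrix.smul_mul]
    have e2 : Qᵀ * Q * G * Qᵀ * C = Qᵀ * (Q * G * Qᵀ * C) := by simp only [Matrix.mul_assoc]
    rw [e2, hC', Matrix.mul_one, Matrix.mul_sub, Matrix.mul_smul, Matrix.mul_one]
    abel
  · -- (2,1): Q(G − GQᵀCQG) = 0
    rw [Matrix.mul_sub, Matrix.zero_mul, add_zero]
    have e1 : Q * (G * Qᵀ * C * Q * G) = (Q * G * Qᵀ * C) * Q * G := by simp only [Matrix.mul_assoc]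
    rw [e1, hC', Matrix.one_mul, sub_self]
  · -- (2,2): Q(GQᵀC) = 1
    rw [Matrix.zero_mul, add_zero]
    have e1 : Q * (G * Qᵀ * C) = Q * G * Qᵀ * C := by simp only [Matrix.mul_assoc]
    rw [e1, hC']

/-- [folklore] **LEFT INVERSE** (transposed hypotheses): `G(K + a′QᵀQ) = 1` and `C(QGQᵀ) = 1` ⟹ `massiveBlocks G Q C a′ · kkt K Q = 1`. -/
theorem massiveBlocks_mul_kkt (K G : Matrix ν ν 𝕜) (Q : Matrix μ ν 𝕜) (C : Matrix μ μ 𝕜) (a' : 𝕜)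
    (hG : G * (K + a' • (Qᵀ * Q)) = 1) (hC : C * (Q * G * Qᵀ) = 1) :
    massiveBlocks G Q C a' * kkt K Q = 1 := by
  have hGK : G * K = 1 - a' • (G * Qᵀ * Q) := by
    rw [Matrix.mul_add, Matrix.mul_smul] at hG
    rw [← hG]; simp only [Matrix.mul_assoc]; abel
  have hC' : C * Q * G * Qᵀ = 1 := by simpa only [Matrix.mul_assoc] using hC
  rw [kkt, massiveBlocks, Matrix.fromBlocks_multiply, ← Matrix.fromBlocks_one]
  congr 1
  · -- (G − GQᵀCQG)K + GQᵀC Q = 1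
    rw [Matrix.sub_mul]
    have e1 : G * Qᵀ * C * Q * G * K = G * Qᵀ * C * Q * (G * K) := by simp only [Matrix.mul_assoc]
    rw [e1, hGK, Matrix.mul_sub, Matrix.mul_one, Matrix.mul_smul]
    have e2 : G * Qᵀ * C * Q * (G * Qᵀ * Q) = G * Qᵀ * (C * Q * G * Qᵀ) * Q := by simp only [Matrix.mul_assoc]
    rw [e2, hC', Matrix.mul_one]
    simp only [Matrix.mul_assoc]
    abel
  · -- (G − GQᵀCQG)Qᵀ + GQᵀC·0 = 0
    rw [Matrix.mul_zero, add_zero, Matrix.sub_mul]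
    have e1 : G * Qᵀ * C * Q * G * Qᵀ = G * Qᵀ * (C * Q * G * Qᵀ) := by simp only [Matrix.mul_assoc]
    rw [e1, hC', Matrix.mul_one, sub_self]
  · -- CQG K + (a′ − C) Q = 0
    have e1 : C * Q * G * K = C * Q * (G * K) := by simp only [Matrix.mul_assoc]
    rw [e1, hGK, Matrix.mul_sub, Matrix.mul_one, Matrix.mul_smul, Matrix.sub_mul, Matrix.smul_mul, Matrix.one_mul]
    have e2 : C * Q * (G * Qᵀ * Q) = (C * Q * G * Qᵀ) * Q := by simp only [Matrix.mul_assoc]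
    rw [e2, hC', Matrix.one_mul]
    abel
  · -- CQG Qᵀ + (a′ − C)·0 = 1
    rw [Matrix.mul_zero, add_zero, hC']

/-- [folklore] **THE INVERSE OF THE SHARP-CONSTRAINT BORDERED SYSTEM** from the massive resolvent: under both-sided hypotheses,
`kkt K Q` is invertible and `(kkt K Q)⁻¹ = massiveBlocks G Q C a′`. -/
theorem kkt_inv_eq_massiveBlocks (K G : Matrix ν ν 𝕜) (Q : Matrix μ ν 𝕜) (C : Matrix μ μ 𝕜) (a' : 𝕜)
    (hG : (K + a' • (Qᵀ * Q)) * G = 1) (hC : (Q * G * Qᵀ) * C = 1) :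
    (kkt K Q)⁻¹ = massiveBlocks G Q C a' :=
  Matrix.inv_eq_right_inv (kkt_mul_massiveBlocks K G Q C a' hG hC)

end Summit.QuantumFields.BalabanUV.Beta.D1BFx.BorderedInverseMassive
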